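import Literature.NumberTheory.ComplexMultiplication.ReflexTypeNormInclusionOverfield
import Literature.NumberTheory.ComplexMultiplication.KottwitzDeterminantPolynomialIntegrality
import Literature.NumberTheory.ComplexMultiplication.ComplexReflexField
import HarnessLib

/-!
# For `α ∈ g(𝔭)` the polynomial `∏_{φ ∈ Φ} (X − φ(α))` lies in `𝔬_{K*}[X]` and is `≡ X^g (mod 𝔭)`
# (Shimura 1998, §13.1–§13.2 and §18.6, proof of Thm. 18.6 (reduction modulo 𝔓 passage), pp. 127–128; Kottwitz 1992 §5 for the integrality)

Topic `Literature/NumberTheory/ComplexMultiplication`, namespace `Literature.NumberTheory.ComplexMultiplication`.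
Cell `hodgecm-mathlib` (D-0151), fan B-II, E2 background programme, piece **(P1-𝔭)** of A-p02's `P1-SPEC.md`
(«cotangentMap R.reduction (R.redEnd (ιA α)) = 0 for α ∈ g(𝔭), p ∤ disc K» — the NUMBER-THEORETIC input: the
characteristic polynomial of `ι(α)` on the tangent space, `∏_{φ∈Φ}(X − φ(α))`, has all its non-leading coefficients in `𝔭`).
Theorems only; no definition, no named fact, no `sorry`.

## Mathematics

`K` a number field with a CM type `Φ ⊆ Hom(K, ℂ)` (`|Φ| = g`), `K* = traceField Φ ⊂ ℂ` its reflex field, `𝔭` a prime of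
`K*`, and `𝔮 = g(𝔭) ⊆ 𝔬_K` its reflex type norm, read — as in the hypothesis `_h𝔮` of `shimuraTaniyamaPair_degOne'` — in a
normal number field `Lg` with `ι : Lg → ℂ`, `j : K → Lg`, `σ₀ : K* → Lg`, `ι ∘ σ₀ = (K* ⊂ ℂ)`:
`IsReflexTypeNorm (valuedIn ι Φ) j σ₀ 𝔭 𝔮`.  For `a ∈ 𝔬_K` the polynomial `∏_{φ∈Φ}(X − φ(a)) ∈ ℂ[X]` has coefficients in
`𝔬_{K*}` (they are symmetric functions of the `φ(a)`, fixed by the stabiliser of `Φ` in `Aut(ℂ)`, and algebraic integers —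
Kottwitz's «in fact they lie in `𝒪_E`», tree `exists_monic_map_eq_prod_X_sub_C_pow` with `r = 𝟙_Φ`); call the monic lift
`Q ∈ 𝔬_{K*}[X]`.  **For `α ∈ 𝔮` every non-leading coefficient of `Q` lies in `𝔭`, i.e. `Q ≡ X^g (mod 𝔭)`**: choose a prime
`𝔓̃` of `Lg` above `σ₀(𝔭)`; by the reflex inclusion (`IsReflexTypeNorm.mapRingHom_mem`, file `ReflexTypeNormInclusion`)
every root `φ_L(α)`, `φ_L ∈ valuedIn ι Φ`, of `Q^{σ₀} = ∏_{φ_L}(X − φ_L(α))` lies in `𝔓̃`, so `Q^{σ₀} ≡ X^g (mod 𝔓̃)` and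
`𝔓̃ ∩ σ₀(𝔬_{K*}) = σ₀(𝔭)`.  This is the content of Shimura's pp. 127–128 (proof of Thm. 18.6, reduction modulo 𝔓
passage) / §13.2 step «`ι̃(α)` acts nilpotently on the tangent space of the reduction» (there phrased with the basis
`ω̃ᵢ`); the E2 road uses it as «charpoly `≡ X^g`».

## What is here (all proved)

* §1 generic polynomial lemmas: `map_mk_eq_X_pow_of_forall_coeff_mem` (monic + lower coefficients in `I` ⇒ `≡ X^n mod I`),
  `coeff_mem_of_map_mk_eq_X_pow`, `coeff_prod_X_sub_C_mem` (roots in `I` ⇒ lower coefficients in `I`).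
* §2 `prod_X_sub_C_pow_indicator_eq_prod_subtype` (Kottwitz's `∏_φ (X − φ a)^{r_φ}` at `r = 𝟙_Φ` is `∏_{φ∈Φ}(X − φ a)`;
  with the tree's `adjoin_sum_indicator_eq_traceField`, `E_{𝟙_Φ} = traceField Φ`), **`exists_monic_map_eq_prod_cmType`**
  (`∃ Q ∈ 𝔬_{K*}[X]` monic of degree `|Φ|` with `Q^ℂ = ∏_{φ∈Φ}(X − φ(a))`), `map_eq_prod_cmType_unique`.
* §3 **`coeff_mem_of_isReflexTypeNorm`** (the congruence with explicit `Lg, ι, j, σ₀`), **`map_mk_eq_X_pow_of_isReflexTypeNorm`**,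
  and the `_h𝔮`-form **`coeff_mem_of_exists_isReflexTypeNorm`** / `map_mk_eq_X_pow_of_exists_isReflexTypeNorm`.
* §4 the `k`-level corollary consumed by the assembly of `shimuraTaniyamaPair_degOne'` (`i₀ : K* → k`, `𝔓 ∩ K* = 𝔭`):
  **`exists_monic_coeff_mem_map_eq_prod_cmType`** (`∃ P ∈ 𝔬_k[X]` monic, `deg = |Φ|`, lower coefficients in `𝔓`,
  `P ≡ X^g mod 𝔓`, `P^ℂ = ∏_{φ∈Φ}(X − φ(α))`) and the uniqueness `eq_map_of_map_eq_prod_cmType`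
  (any `P' ∈ k[X]` with `P'^ℂ = ∏_{φ∈Φ}(X − φ(α))` is `P` read in `k`).
* §5 **`exists_mem_coeff_prod_cmType_eq_algebraMap`** — the statement in the EXACT shape of the E2 line's stub `stub_P1p`
  (A-p02's `P1-skeleton.lean`): `∃ x ∈ 𝔭, (∏_{φ∈Φ}(X − φ α)).coeff i = x` for `i < |Φ|`.

## References

* [Shimura1998] G. Shimura, *Abelian Varieties with Complex Multiplication and Modular Functions*, Princeton 1998:
  §13.1 (1), (7); §13.2 (pp. 99–100); §18.6, proof of Thm. 18.6, reduction modulo 𝔓 passage (pp. 127–128).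
* [Kottwitz1992] R. E. Kottwitz, *Points on some Shimura varieties over finite fields*, JAMS 5 (1992), §5 pp. 389–390.
-/

noncomputable section

open scoped NumberField Pointwise nonZeroDivisors Classical
open NumberField Polynomial

namespace Literature.NumberTheory.ComplexMultiplication

open Literature.AlgebraicGeometry.Motives (CMType)

/-! ## §1. Generic polynomial lemmas: «`≡ X^n (mod I)`» -/

section Poly

variable {R : Type*} [CommRing R]

/-- A monic polynomial whose non-leading coefficients lie in the ideal `I` reduces to `X^{deg}` modulo `I`. [folklore] -/
private theorem coeff_X_pow_of_ne {n i : ℕ} (h : i ≠ n) : ((X : R[X]) ^ n).coeff i = 0 := by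
  rw [coeff_X_pow, if_neg h]

/-- **Monic with lower coefficients in `I` ⇒ `f ≡ X^{deg f} (mod I)`.**
[cite: Shimura1998, §18.6, proof of Thm. 18.6 (reduction modulo 𝔓 passage), pp. 127–128] -/
theorem map_mk_eq_X_pow_of_forall_coeff_mem (I : Ideal R) {f : R[X]} (hf : f.Monic)
    (h : ∀ i < f.natDegree, f.coeff i ∈ I) : f.map (Ideal.Quotient.mk I) = X ^ f.natDegree := by
  ext i
  rw [coeff_map, coeff_X_pow]
  rcases lt_trichotomy i f.natDegree with hi | rfl | hi
  · rw [if_neg hi.ne, Ideal.Quotient.eq_zero_iff_mem]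
    exact h i hi
  · rw [if_pos rfl, hf.coeff_natDegree, map_one]
  · rw [if_neg hi.ne', coeff_eq_zero_of_natDegree_lt hi, map_zero]

/-- Conversely, `f ≡ X^n (mod I)` puts every coefficient of index `≠ n` in `I`.
[cite: Shimura1998, §18.6, proof of Thm. 18.6 (reduction modulo 𝔓 passage), pp. 127–128] -/
theorem coeff_mem_of_map_mk_eq_X_pow (I : Ideal R) {f : R[X]} {n : ℕ} (h : f.map (Ideal.Quotient.mk I) = X ^ n)
    {i : ℕ} (hi : i ≠ n) : f.coeff i ∈ I := by
  rw [← Ideal.Quotient.eq_zero_iff_mem, ← coeff_map, h, coeff_X_pow, if_neg hi]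

/-- **Roots in `I` ⇒ `∏ (X − xᵢ) ≡ X^n (mod I)`.** [cite: Shimura1998, §13.2, pp. 99–100] -/
theorem map_mk_prod_X_sub_C_eq_X_pow {ι : Type*} [Fintype ι] (I : Ideal R) (x : ι → R) (hx : ∀ i, x i ∈ I) :
    (∏ i, (X - C (x i))).map (Ideal.Quotient.mk I) = X ^ Fintype.card ι := by
  rw [Polynomial.map_prod]
  have h : ∀ i : ι, (X - C (x i)).map (Ideal.Quotient.mk I) = X := fun i => by
    rw [Polynomial.map_sub, map_X, map_C, Ideal.Quotient.eq_zero_iff_mem.2 (hx i), map_zero, sub_zero]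
  simp only [h, Finset.prod_const, Finset.card_univ]

/-- Roots in `I` ⇒ the coefficients of `∏ᵢ (X − xᵢ)` of index `≠ n` (the number of roots) lie in `I`: the elementary
symmetric functions of elements of `I` of positive degree lie in `I`. [cite: Shimura1998, §13.2, pp. 99–100] -/
theorem coeff_prod_X_sub_C_mem {ι : Type*} [Fintype ι] (I : Ideal R) (x : ι → R) (hx : ∀ i, x i ∈ I) {k : ℕ}
    (hk : k ≠ Fintype.card ι) : (∏ i, (X - C (x i))).coeff k ∈ I :=
  coeff_mem_of_map_mk_eq_X_pow I (map_mk_prod_X_sub_C_eq_X_pow I x hx) hk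

end Poly

/-! ## §2. `∏_{φ ∈ Φ} (X − φ(a))` is the image of a monic polynomial over `𝔬_{K*}`, `K* = traceField Φ` -/

section Lift

variable {K : Type} [Field K] [NumberField K]

/-- Kottwitz's `∏_φ (X − φ(a))^{r_φ}` at the indicator `r = 𝟙_Φ` of a set of embeddings is `∏_{φ ∈ Φ} (X − φ(a))`
(product over the subtype). [cite: Kottwitz1992, §5 p. 390] -/
theorem prod_X_sub_C_pow_indicator_eq_prod_subtype (S : Set (K →+* ℂ)) (a : K) :
    ∏ φ : K →+* ℂ, (X - C (φ a)) ^ (if φ ∈ S then 1 else 0) = ∏ φ : S, (X - C (φ.1 a)) := by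
  have h1 : ∏ φ : K →+* ℂ, (X - C (φ a)) ^ (if φ ∈ S then 1 else 0) =
      ∏ φ : K →+* ℂ, (if φ ∈ S then (X - C (φ a)) else 1) :=
    Finset.prod_congr rfl fun φ _ => by split_ifs <;> simp
  have hS : Finset.univ.filter (fun φ : K →+* ℂ => φ ∈ S) = S.toFinset := by
    ext φ
    simp only [Finset.mem_filter, Finset.mem_univ, true_and, Set.mem_toFinset]
  rw [h1, ← Finset.prod_filter, hS]
  exact Finset.prod_subtype S.toFinset (fun _ => Set.mem_toFinset) fun φ : K →+* ℂ => X - C (φ a)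

/-- **`∏_{φ ∈ Φ} (X − φ(a)) ∈ 𝔬_{K*}[X]`**: for `a ∈ 𝔬_K` the polynomial `∏_{φ∈Φ}(X − φ(a))` is the image in `ℂ[X]` of a
MONIC polynomial of degree `|Φ|` over the ring of integers of the reflex field `K* = traceField Φ` (its coefficients are
symmetric functions of the `φ(a)`, fixed by the stabiliser of `Φ`, and algebraic integers — Kottwitz's «in fact they lie in
`𝒪_E`» at `r = 𝟙_Φ`). [cite: Kottwitz1992, §5 pp. 389–390] [cite: Shimura1998, §8.3 Prop. 28; §13.1] -/
theorem exists_monic_map_eq_prod_cmType (Φ : CMType K) (a : 𝓞 K) :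
    ∃ Q : (𝓞 (traceField Φ))[X], Q.Monic ∧ Q.natDegree = Fintype.card Φ.1 ∧
      Q.map (algebraMap (𝓞 (traceField Φ)) ℂ) = ∏ φ : Φ.1, (X - C (φ.1 (a : K))) := by
  have hQ := exists_monic_map_eq_prod_X_sub_C_pow (fun ψ : K →+* ℂ => if ψ ∈ Φ.1 then 1 else 0) a
  rw [adjoin_sum_indicator_eq_traceField Φ] at hQ
  obtain ⟨Q, hmon, hdeg, hmap⟩ := hQ
  refine ⟨Q, hmon, ?_, ?_⟩
  · rw [hdeg, Fintype.card_subtype]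
    simp only [Finset.sum_boole, Nat.cast_id]
  · rw [hmap]
    exact prod_X_sub_C_pow_indicator_eq_prod_subtype Φ.1 (a : K)

/-- The lift is unique (extension of scalars `𝔬_{K*}[X] → ℂ[X]` is injective). [cite: Kottwitz1992, §5 pp. 389–390] -/
theorem map_eq_prod_cmType_unique (Φ : CMType K) (a : 𝓞 K) {Q Q' : (𝓞 (traceField Φ))[X]}
    (hQ : Q.map (algebraMap (𝓞 (traceField Φ)) ℂ) = ∏ φ : Φ.1, (X - C (φ.1 (a : K))))
    (hQ' : Q'.map (algebraMap (𝓞 (traceField Φ)) ℂ) = ∏ φ : Φ.1, (X - C (φ.1 (a : K)))) : Q = Q' :=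
  Polynomial.map_injective _ (FaithfulSMul.algebraMap_injective _ _) (hQ.trans hQ'.symm)

end Lift

/-! ## §3. `α ∈ 𝔮 = g(𝔭)` ⇒ `∏_{φ∈Φ}(X − φ(α)) ≡ X^g (mod 𝔭)` -/

section Congruence

variable {K : Type} [Field K] [NumberField K] (Φ : CMType K) [NumberField (traceField Φ)]
  {Lg : Type} [Field Lg] [NumberField Lg] [Normal ℚ Lg]

/-- Restricting a field embedding to rings of integers is injective. [folklore] -/
private theorem mapRingHom_injective {k L : Type*} [Field k] [Field L] (σ : k →+* L) :
    Function.Injective (RingOfIntegers.mapRingHom σ) := fun x y h => by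
  apply RingOfIntegers.eq_iff.mp
  apply σ.injective
  have h' := congrArg (fun z : 𝓞 L => (z : L)) h
  simpa only [RingOfIntegers.mapRingHom_apply] using h'

omit [NumberField Lg] [Normal ℚ Lg] in
/-- The embedding `𝔬_{Lg} → ℂ` (through `ι`) is injective, hence so is `𝔬_{Lg}[X] → ℂ[X]`. [folklore] -/
private theorem map_comp_coe_injective (ι : Lg →+* ℂ) :
    Function.Injective (Polynomial.map (ι.comp (algebraMap (𝓞 Lg) Lg))) :=
  Polynomial.map_injective _ (ι.injective.comp (FaithfulSMul.algebraMap_injective (𝓞 Lg) Lg))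

omit [NumberField (traceField Φ)] [NumberField Lg] [Normal ℚ Lg] in
/-- `ι ∘ σ₀ = (K* ⊂ ℂ)` on rings of integers: `ι(σ₀(x)) = x` for `x ∈ 𝔬_{K*}`. [folklore] -/
private theorem comp_coe_comp_mapRingHom_eq {ι : Lg →+* ℂ} {σ₀ : traceField Φ →+* Lg}
    (hισ₀ : ι.comp σ₀ = algebraMap (traceField Φ) ℂ) :
    (ι.comp (algebraMap (𝓞 Lg) Lg)).comp (RingOfIntegers.mapRingHom σ₀) = algebraMap (𝓞 (traceField Φ)) ℂ := by
  refine RingHom.ext fun x => ?_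
  rw [IsScalarTower.algebraMap_eq (𝓞 (traceField Φ)) (traceField Φ) ℂ, ← hισ₀]
  rfl

omit [NumberField (traceField Φ)] in
/-- The embeddings `K → Lg` with complex shadow in `Φ` are in bijection with `Φ` by `φ ↦ ι ∘ φ` (`Lg/ℚ` normal containing
`j(K)`: every `ψ ∈ Φ` factors through `Lg`, `exists_ringHom_comp_eq_of_normal`). [cite: Shimura1998, §13.1, p. 96] -/
theorem bijective_comp_valuedIn (ι : Lg →+* ℂ) (j : K →+* Lg) :
    Function.Bijective (fun φ : valuedIn ι Φ.1 => (⟨ι.comp φ.1, φ.2⟩ : Φ.1)) := by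
  constructor
  · rintro ⟨φ₁, h₁⟩ ⟨φ₂, h₂⟩ h
    have h' : ι.comp φ₁ = ι.comp φ₂ := congrArg Subtype.val h
    exact Subtype.ext (RingHom.ext fun x => ι.injective (by simpa using RingHom.congr_fun h' x))
  · rintro ⟨ψ, hψ⟩
    obtain ⟨φ, hφ⟩ := exists_ringHom_comp_eq_of_normal j ι ψ
    exact ⟨⟨φ, show ι.comp φ ∈ Φ.1 by rw [hφ]; exact hψ⟩, Subtype.ext hφ⟩

omit [NumberField (traceField Φ)] in
/-- `|valuedIn ι Φ| = |Φ|`. [cite: Shimura1998, §13.1, p. 96] -/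
theorem card_valuedIn_eq (ι : Lg →+* ℂ) (j : K →+* Lg) : Fintype.card (valuedIn ι Φ.1) = Fintype.card Φ.1 :=
  Fintype.card_congr (Equiv.ofBijective _ (bijective_comp_valuedIn Φ ι j))

omit [NumberField (traceField Φ)] in
/-- **The lift read in `Lg`: `Q^{σ₀} = ∏_{φ_L ∈ valuedIn ι Φ} (X − φ_L(α))` in `𝔬_{Lg}[X]`** (both sides have image
`∏_{φ∈Φ}(X − φ(α))` in `ℂ[X]`, the right one through the bijection `φ_L ↦ ι ∘ φ_L`). [cite: Shimura1998, §13.1, p. 96; §13.2, pp. 99–100] -/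
theorem map_mapRingHom_eq_prod_valuedIn {ι : Lg →+* ℂ} (j : K →+* Lg) {σ₀ : traceField Φ →+* Lg}
    (hισ₀ : ι.comp σ₀ = algebraMap (traceField Φ) ℂ) (α : 𝓞 K) {Q : (𝓞 (traceField Φ))[X]}
    (hQ : Q.map (algebraMap (𝓞 (traceField Φ)) ℂ) = ∏ φ : Φ.1, (X - C (φ.1 (α : K)))) :
    Q.map (RingOfIntegers.mapRingHom σ₀) =
      ∏ φ : valuedIn ι Φ.1, (X - C (RingOfIntegers.mapRingHom φ.1 α)) := by
  apply map_comp_coe_injective ι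
  rw [Polynomial.map_map, comp_coe_comp_mapRingHom_eq Φ hισ₀, hQ, Polynomial.map_prod]
  simp only [Polynomial.map_sub, map_X, map_C]
  symm
  refine Fintype.prod_equiv (Equiv.ofBijective _ (bijective_comp_valuedIn Φ ι j)) _ _ fun φ => ?_
  rfl

/-- **(P1-𝔭) `α ∈ g(𝔭)` ⇒ every non-leading coefficient of `∏_{φ∈Φ}(X − φ(α)) ∈ 𝔬_{K*}[X]` lies in `𝔭`** (explicit
reflex data `Lg, ι, j, σ₀`): choose a prime `𝔓̃` of `𝔬_{Lg}` over `𝔭` along `σ₀`; the roots `φ_L(α)` of `Q^{σ₀}` lie in `𝔓̃`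
by the reflex inclusion `φ_L(𝔮)𝔬_{Lg} ⊆ 𝔭^{σ₀}𝔬_{Lg} ⊆ 𝔓̃` (`IsReflexTypeNorm.mapRingHom_mem`), so `Q^{σ₀} ≡ X^g (mod 𝔓̃)`, and
`σ₀⁻¹(𝔓̃) = 𝔭`. [cite: Shimura1998, §13.2, pp. 99–100; §18.6, proof of Thm. 18.6 (reduction modulo 𝔓 passage), pp. 127–128] -/
theorem coeff_mem_of_isReflexTypeNorm {ι : Lg →+* ℂ} {j : K →+* Lg} {σ₀ : traceField Φ →+* Lg}
    (hισ₀ : ι.comp σ₀ = algebraMap (traceField Φ) ℂ) {𝔭 : IsDedekindDomain.HeightOneSpectrum (𝓞 (traceField Φ))}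
    {𝔮 : Ideal (𝓞 K)} (h : IsReflexTypeNorm (valuedIn ι Φ.1) j σ₀ 𝔭.asIdeal 𝔮) {α : 𝓞 K} (hα : α ∈ 𝔮)
    {Q : (𝓞 (traceField Φ))[X]} (hQ : Q.map (algebraMap (𝓞 (traceField Φ)) ℂ) = ∏ φ : Φ.1, (X - C (φ.1 (α : K))))
    {i : ℕ} (hi : i ≠ Fintype.card Φ.1) : Q.coeff i ∈ 𝔭.asIdeal := by
  -- a prime `P` of `𝓞 Lg` above `𝔭` along `σ₀`
  letI : Algebra (traceField Φ) Lg := σ₀.toAlgebra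
  have halg : algebraMap (𝓞 (traceField Φ)) (𝓞 Lg) = RingOfIntegers.mapRingHom σ₀ := rfl
  have hker : Ideal.comap (algebraMap (𝓞 (traceField Φ)) (𝓞 Lg)) ⊥ ≤ 𝔭.asIdeal := by
    intro x hx
    rw [Ideal.mem_comap, Ideal.mem_bot, halg, ← map_zero (RingOfIntegers.mapRingHom σ₀)] at hx
    rw [mapRingHom_injective σ₀ hx]
    exact zero_mem _
  obtain ⟨P, -, hPprime, hP⟩ := Ideal.exists_ideal_over_prime_of_isIntegral 𝔭.asIdeal (⊥ : Ideal (𝓞 Lg)) hker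
  rw [halg] at hP
  -- the roots of `Q^{σ₀}` lie in `P`
  have h𝔭P : 𝔭.asIdeal.map (RingOfIntegers.mapRingHom σ₀) ≤ P := Ideal.map_le_iff_le_comap.2 hP.ge
  have hroots : ∀ φ : valuedIn ι Φ.1, RingOfIntegers.mapRingHom φ.1 α ∈ P := fun φ =>
    h.mapRingHom_mem φ.2 h𝔭P hα
  -- hence `Q^{σ₀} ≡ X^g (mod P)` and the coefficient lies in `σ₀⁻¹(P) = 𝔭`
  have hcoeff : (Q.map (RingOfIntegers.mapRingHom σ₀)).coeff i ∈ P := by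
    rw [map_mapRingHom_eq_prod_valuedIn Φ j hισ₀ α hQ]
    exact coeff_prod_X_sub_C_mem P _ hroots (by rwa [card_valuedIn_eq Φ ι j])
  rw [coeff_map] at hcoeff
  rw [← hP, Ideal.mem_comap]
  exact hcoeff

/-- The same for the coefficients below the degree of a monic lift of degree `|Φ|`.
[cite: Shimura1998, §13.2, pp. 99–100; §18.6, proof of Thm. 18.6 (reduction modulo 𝔓 passage), pp. 127–128] -/
theorem coeff_mem_of_isReflexTypeNorm_of_lt {ι : Lg →+* ℂ} {j : K →+* Lg} {σ₀ : traceField Φ →+* Lg}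
    (hισ₀ : ι.comp σ₀ = algebraMap (traceField Φ) ℂ) {𝔭 : IsDedekindDomain.HeightOneSpectrum (𝓞 (traceField Φ))}
    {𝔮 : Ideal (𝓞 K)} (h : IsReflexTypeNorm (valuedIn ι Φ.1) j σ₀ 𝔭.asIdeal 𝔮) {α : 𝓞 K} (hα : α ∈ 𝔮)
    {Q : (𝓞 (traceField Φ))[X]} (hdeg : Q.natDegree = Fintype.card Φ.1)
    (hQ : Q.map (algebraMap (𝓞 (traceField Φ)) ℂ) = ∏ φ : Φ.1, (X - C (φ.1 (α : K))))
    {i : ℕ} (hi : i < Q.natDegree) : Q.coeff i ∈ 𝔭.asIdeal :=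
  coeff_mem_of_isReflexTypeNorm Φ hισ₀ h hα hQ (by rw [← hdeg]; exact hi.ne)

/-- **`Q ≡ X^g (mod 𝔭)`** for the monic lift `Q` of `∏_{φ∈Φ}(X − φ(α))`, `α ∈ g(𝔭)` (explicit reflex data).
[cite: Shimura1998, §13.2, pp. 99–100; §18.6, proof of Thm. 18.6 (reduction modulo 𝔓 passage), pp. 127–128] -/
theorem map_mk_eq_X_pow_of_isReflexTypeNorm {ι : Lg →+* ℂ} {j : K →+* Lg} {σ₀ : traceField Φ →+* Lg}
    (hισ₀ : ι.comp σ₀ = algebraMap (traceField Φ) ℂ) {𝔭 : IsDedekindDomain.HeightOneSpectrum (𝓞 (traceField Φ))}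
    {𝔮 : Ideal (𝓞 K)} (h : IsReflexTypeNorm (valuedIn ι Φ.1) j σ₀ 𝔭.asIdeal 𝔮) {α : 𝓞 K} (hα : α ∈ 𝔮)
    {Q : (𝓞 (traceField Φ))[X]} (hmon : Q.Monic) (hdeg : Q.natDegree = Fintype.card Φ.1)
    (hQ : Q.map (algebraMap (𝓞 (traceField Φ)) ℂ) = ∏ φ : Φ.1, (X - C (φ.1 (α : K)))) :
    Q.map (Ideal.Quotient.mk 𝔭.asIdeal) = X ^ Fintype.card Φ.1 := by
  rw [← hdeg]
  exact map_mk_eq_X_pow_of_forall_coeff_mem _ hmon fun i hi =>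
    coeff_mem_of_isReflexTypeNorm_of_lt Φ hισ₀ h hα hdeg hQ hi

/-- **(P1-𝔭) in the currency of `shimuraTaniyamaPair_degOne'`**: with its hypothesis `_h𝔮` VERBATIM
(`∃ Lg … ι j σ₀, ι ∘ σ₀ = (K* ⊂ ℂ) ∧ IsReflexTypeNorm (valuedIn ι Φ) j σ₀ 𝔭 𝔮`) and `α ∈ 𝔮`, every coefficient of index
`≠ |Φ|` of any lift `Q ∈ 𝔬_{K*}[X]` of `∏_{φ∈Φ}(X − φ(α))` lies in `𝔭`.
[cite: Shimura1998, §13.2, pp. 99–100; §18.6, proof of Thm. 18.6 (reduction modulo 𝔓 passage), pp. 127–128] -/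
theorem coeff_mem_of_exists_isReflexTypeNorm {𝔭 : IsDedekindDomain.HeightOneSpectrum (𝓞 (traceField Φ))}
    {𝔮 : Ideal (𝓞 K)}
    (h𝔮 : ∃ (Lg : Type) (_ : Field Lg) (_ : NumberField Lg) (_ : Normal ℚ Lg) (ι : Lg →+* ℂ)
        (j : K →+* Lg) (σ₀ : traceField Φ →+* Lg),
        ι.comp σ₀ = algebraMap (traceField Φ) ℂ ∧ IsReflexTypeNorm (valuedIn ι Φ.1) j σ₀ 𝔭.asIdeal 𝔮)
    {α : 𝓞 K} (hα : α ∈ 𝔮) {Q : (𝓞 (traceField Φ))[X]}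
    (hQ : Q.map (algebraMap (𝓞 (traceField Φ)) ℂ) = ∏ φ : Φ.1, (X - C (φ.1 (α : K)))) {i : ℕ}
    (hi : i ≠ Fintype.card Φ.1) : Q.coeff i ∈ 𝔭.asIdeal := by
  obtain ⟨Lg, _, _, _, ι, j, σ₀, hισ₀, h⟩ := h𝔮
  exact coeff_mem_of_isReflexTypeNorm Φ hισ₀ h hα hQ hi

/-- **`∏_{φ∈Φ}(X − φ(α)) ≡ X^g (mod 𝔭)` for `α ∈ g(𝔭)`** (`_h𝔮` form; `Q` the monic lift of degree `|Φ|`).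
[cite: Shimura1998, §13.2, pp. 99–100; §18.6, proof of Thm. 18.6 (reduction modulo 𝔓 passage), pp. 127–128] -/
theorem map_mk_eq_X_pow_of_exists_isReflexTypeNorm {𝔭 : IsDedekindDomain.HeightOneSpectrum (𝓞 (traceField Φ))}
    {𝔮 : Ideal (𝓞 K)}
    (h𝔮 : ∃ (Lg : Type) (_ : Field Lg) (_ : NumberField Lg) (_ : Normal ℚ Lg) (ι : Lg →+* ℂ)
        (j : K →+* Lg) (σ₀ : traceField Φ →+* Lg),
        ι.comp σ₀ = algebraMap (traceField Φ) ℂ ∧ IsReflexTypeNorm (valuedIn ι Φ.1) j σ₀ 𝔭.asIdeal 𝔮)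
    {α : 𝓞 K} (hα : α ∈ 𝔮) {Q : (𝓞 (traceField Φ))[X]} (hmon : Q.Monic) (hdeg : Q.natDegree = Fintype.card Φ.1)
    (hQ : Q.map (algebraMap (𝓞 (traceField Φ)) ℂ) = ∏ φ : Φ.1, (X - C (φ.1 (α : K)))) :
    Q.map (Ideal.Quotient.mk 𝔭.asIdeal) = X ^ Fintype.card Φ.1 := by
  obtain ⟨Lg, _, _, _, ι, j, σ₀, hισ₀, h⟩ := h𝔮
  exact map_mk_eq_X_pow_of_isReflexTypeNorm Φ hισ₀ h hα hmon hdeg hQ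

/-- **(P1-𝔭), packaged**: for `α ∈ 𝔮 = g(𝔭)` there is a monic `Q ∈ 𝔬_{K*}[X]` of degree `|Φ|` with
`Q^ℂ = ∏_{φ∈Φ}(X − φ(α))`, all coefficients below the degree in `𝔭`, and `Q ≡ X^{|Φ|} (mod 𝔭)`.
[cite: Shimura1998, §13.2, pp. 99–100; §18.6, proof of Thm. 18.6 (reduction modulo 𝔓 passage), pp. 127–128] [cite: Kottwitz1992, §5 pp. 389–390] -/
theorem exists_monic_coeff_mem_of_exists_isReflexTypeNorm {𝔭 : IsDedekindDomain.HeightOneSpectrum (𝓞 (traceField Φ))}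
    {𝔮 : Ideal (𝓞 K)}
    (h𝔮 : ∃ (Lg : Type) (_ : Field Lg) (_ : NumberField Lg) (_ : Normal ℚ Lg) (ι : Lg →+* ℂ)
        (j : K →+* Lg) (σ₀ : traceField Φ →+* Lg),
        ι.comp σ₀ = algebraMap (traceField Φ) ℂ ∧ IsReflexTypeNorm (valuedIn ι Φ.1) j σ₀ 𝔭.asIdeal 𝔮)
    {α : 𝓞 K} (hα : α ∈ 𝔮) :
    ∃ Q : (𝓞 (traceField Φ))[X], Q.Monic ∧ Q.natDegree = Fintype.card Φ.1 ∧
      (∀ i < Q.natDegree, Q.coeff i ∈ 𝔭.asIdeal) ∧ Q.map (Ideal.Quotient.mk 𝔭.asIdeal) = X ^ Fintype.card Φ.1 ∧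
      Q.map (algebraMap (𝓞 (traceField Φ)) ℂ) = ∏ φ : Φ.1, (X - C (φ.1 (α : K))) := by
  obtain ⟨Q, hmon, hdeg, hQ⟩ := exists_monic_map_eq_prod_cmType Φ α
  exact ⟨Q, hmon, hdeg, fun i hi => coeff_mem_of_exists_isReflexTypeNorm Φ h𝔮 hα hQ (by rw [← hdeg]; exact hi.ne),
    map_mk_eq_X_pow_of_exists_isReflexTypeNorm Φ h𝔮 hα hmon hdeg hQ, hQ⟩

end Congruence

/-! ## §4. Read in the field of definition `k ⊇ K*` modulo the prime `𝔓 ∣ 𝔭` -/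

section OverK

variable {K : Type} [Field K] [NumberField K] (Φ : CMType K) [NumberField (traceField Φ)]
  {k : Type} [Field k] [Algebra k ℂ]

omit [NumberField (traceField Φ)] in
/-- `(k ⊂ ℂ) ∘ i₀ = (K* ⊂ ℂ)` on rings of integers. [folklore] -/
private theorem algebraMap_comp_mapRingHom_eq {i₀ : traceField Φ →+* k}
    (hi₀ : (algebraMap k ℂ).comp i₀ = algebraMap (traceField Φ) ℂ) :
    (algebraMap (𝓞 k) ℂ).comp (RingOfIntegers.mapRingHom i₀) = algebraMap (𝓞 (traceField Φ)) ℂ := by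
  refine RingHom.ext fun x => ?_
  rw [IsScalarTower.algebraMap_eq (𝓞 (traceField Φ)) (traceField Φ) ℂ, ← hi₀,
    IsScalarTower.algebraMap_eq (𝓞 k) k ℂ]
  rfl

/-- **(P1-𝔭) over the field of definition — the form the assembly of `shimuraTaniyamaPair_degOne'` consumes.**  With the
fact's binders `i₀ : K* → k`, `_hi₀`, `𝔓 ∣ 𝔭` (`_h𝔓 : 𝔓 ∩ K* = 𝔭`), `_h𝔮` and `α ∈ 𝔮`: there is a monic `P ∈ 𝔬_k[X]` of
degree `|Φ|` with `P^ℂ = ∏_{φ∈Φ}(X − φ(α))`, all coefficients below the degree in `𝔓`, and `P ≡ X^{|Φ|} (mod 𝔓)` — so the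
characteristic polynomial of `ι(α)` on the tangent space (which is `P` read in `k`, by (P1-CM) and `eq_map_of_map_eq_prod_cmType`)
reduces to `X^g` modulo `𝔓`: «`ι̃(α)` is nilpotent on the tangent space of the reduction».
[cite: Shimura1998, §13.2, pp. 99–100; §18.6, proof of Thm. 18.6 (reduction modulo 𝔓 passage), pp. 127–128] [cite: Kottwitz1992, §5 pp. 389–390] -/
theorem exists_monic_coeff_mem_map_eq_prod_cmType (i₀ : traceField Φ →+* k)
    (hi₀ : (algebraMap k ℂ).comp i₀ = algebraMap (traceField Φ) ℂ)
    (𝔭 : IsDedekindDomain.HeightOneSpectrum (𝓞 (traceField Φ))) (𝔓 : IsDedekindDomain.HeightOneSpectrum (𝓞 k))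
    (h𝔓 : 𝔓.asIdeal.comap (RingOfIntegers.mapRingHom i₀) = 𝔭.asIdeal) (𝔮 : Ideal (𝓞 K))
    (h𝔮 : ∃ (Lg : Type) (_ : Field Lg) (_ : NumberField Lg) (_ : Normal ℚ Lg) (ι : Lg →+* ℂ)
        (j : K →+* Lg) (σ₀ : traceField Φ →+* Lg),
        ι.comp σ₀ = algebraMap (traceField Φ) ℂ ∧ IsReflexTypeNorm (valuedIn ι Φ.1) j σ₀ 𝔭.asIdeal 𝔮)
    (α : 𝓞 K) (hα : α ∈ 𝔮) :
    ∃ P : (𝓞 k)[X], P.Monic ∧ P.natDegree = Fintype.card Φ.1 ∧ (∀ i < P.natDegree, P.coeff i ∈ 𝔓.asIdeal) ∧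
      P.map (Ideal.Quotient.mk 𝔓.asIdeal) = X ^ Fintype.card Φ.1 ∧
      P.map (algebraMap (𝓞 k) ℂ) = ∏ φ : Φ.1, (X - C (φ.1 (α : K))) := by
  obtain ⟨Q, hmon, hdeg, hcoeff, -, hQ⟩ := exists_monic_coeff_mem_of_exists_isReflexTypeNorm Φ h𝔮 hα
  have hmon' : (Q.map (RingOfIntegers.mapRingHom i₀)).Monic := hmon.map _
  have hdeg' : (Q.map (RingOfIntegers.mapRingHom i₀)).natDegree = Fintype.card Φ.1 := by
    rw [hmon.natDegree_map, hdeg]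
  have hcoeff' : ∀ i < (Q.map (RingOfIntegers.mapRingHom i₀)).natDegree,
      (Q.map (RingOfIntegers.mapRingHom i₀)).coeff i ∈ 𝔓.asIdeal := fun i hi => by
    rw [coeff_map, ← Ideal.mem_comap, h𝔓]
    exact hcoeff i (by rw [hdeg]; rwa [hdeg'] at hi)
  refine ⟨Q.map (RingOfIntegers.mapRingHom i₀), hmon', hdeg', hcoeff', ?_, ?_⟩
  · rw [← hdeg']
    exact map_mk_eq_X_pow_of_forall_coeff_mem _ hmon' hcoeff'
  · rw [Polynomial.map_map, algebraMap_comp_mapRingHom_eq Φ hi₀, hQ]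

omit [NumberField (traceField Φ)] in
/-- **Uniqueness over `k`**: any `P' ∈ k[X]` whose image in `ℂ[X]` is `∏_{φ∈Φ}(X − φ(α))` is the `𝔬_k`-polynomial `P`
read in `k` (`k[X] → ℂ[X]` is injective) — this is how the characteristic polynomial of `ι(α)` on `Lie(A)` (P1-CM) meets `P`.
[cite: Shimura1998, §18.6, proof of Thm. 18.6 (reduction modulo 𝔓 passage), pp. 127–128] -/
theorem eq_map_of_map_eq_prod_cmType {α : 𝓞 K} {P : (𝓞 k)[X]}
    (hP : P.map (algebraMap (𝓞 k) ℂ) = ∏ φ : Φ.1, (X - C (φ.1 (α : K)))) {P' : k[X]}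
    (hP' : P'.map (algebraMap k ℂ) = ∏ φ : Φ.1, (X - C (φ.1 (α : K)))) :
    P' = P.map (algebraMap (𝓞 k) k) := by
  apply Polynomial.map_injective (algebraMap k ℂ) (algebraMap k ℂ).injective
  rw [hP', Polynomial.map_map, ← IsScalarTower.algebraMap_eq, hP]

/-- The `toFinset` spelling of the product `∏_{φ∈Φ}(X − φ(a))` (for consumers writing `∏ φ ∈ Φ.1.toFinset`).
[cite: Kottwitz1992, §5 p. 390] -/
theorem prod_subtype_eq_prod_toFinset (S : Set (K →+* ℂ)) (a : K) :
    ∏ φ : S, (X - C (φ.1 a)) = ∏ φ ∈ S.toFinset, (X - C (φ a)) :=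
  (Finset.prod_subtype S.toFinset (fun _ => Set.mem_toFinset) fun φ : K →+* ℂ => X - C (φ a)).symm

end OverK

/-! ## §5. The slot of A-p02's P1 skeleton (`stub_P1p`, text frozen in `A-provers/A-p02/P1-skeleton.lean`) -/

section Slot

/-- **(P1-𝔭) in the exact shape of the E2 line's stub `stub_P1p`** (binders of `shimuraTaniyamaPair_degOne'`; the
instance `[IsCMField K]` of the stub is not needed and omitted): for `α ∈ 𝔮 = g(𝔭)` and `i < |Φ|`, the `i`-th coefficient
of `∏_{φ∈Φ}(X − φ(α)) ∈ ℂ[X]` is the image of an element of `𝔭 ⊆ 𝔬_{K*}`.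
[cite: Shimura1998, §13.2, pp. 99–100; §18.6, proof of Thm. 18.6 (reduction modulo 𝔓 passage), pp. 127–128] [cite: Kottwitz1992, §5 pp. 389–390] -/
theorem exists_mem_coeff_prod_cmType_eq_algebraMap (K : Type) [Field K] [NumberField K] (Φ : CMType K)
    [NumberField (traceField Φ)] (𝔭 : IsDedekindDomain.HeightOneSpectrum (𝓞 (traceField Φ))) (𝔮 : Ideal (𝓞 K))
    (h𝔮 : ∃ (Lg : Type) (_ : Field Lg) (_ : NumberField Lg) (_ : Normal ℚ Lg) (ιL : Lg →+* ℂ)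
        (j : K →+* Lg) (σ₀ : traceField Φ →+* Lg),
        ιL.comp σ₀ = algebraMap (traceField Φ) ℂ ∧ IsReflexTypeNorm (valuedIn ιL Φ.1) j σ₀ 𝔭.asIdeal 𝔮)
    (α : 𝓞 K) (hα : α ∈ 𝔮) (i : ℕ) (hi : i < Fintype.card Φ.1) :
    ∃ x : 𝓞 (traceField Φ), x ∈ 𝔭.asIdeal ∧
      (∏ σ : Φ.1, (Polynomial.X - Polynomial.C ((σ.1 (α : K) : ℂ)))).coeff i =
        algebraMap (traceField Φ) ℂ (x : traceField Φ) := by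
  obtain ⟨Q, -, hdeg, hcoeff, -, hQ⟩ := exists_monic_coeff_mem_of_exists_isReflexTypeNorm Φ h𝔮 hα
  refine ⟨Q.coeff i, hcoeff i (by rw [hdeg]; exact hi), ?_⟩
  rw [← hQ, coeff_map, IsScalarTower.algebraMap_eq (𝓞 (traceField Φ)) (traceField Φ) ℂ]
  rfl

end Slot

end Literature.NumberTheory.ComplexMultiplication

end
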